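import Summits.QuantumFields.YangMills.Theorems.AllWindowsColdBoxBoxHighLineHodgeRows

/-!
# LINE-19 S3b / LINE-20 U1 — STUB-PLAN-U1 §7.2, step 1: the ENTRIES of `hodgeQ` and the skin/rest split

Toward the instantiation of the abstract Schur–Jaffard block-decay theorem (`…AllWindowsColdBox.Jaffard.schur_jaffard_decay`,
✓p727934) for the Hodge precision matrix `hodgeQ H` of the cold box (stub S3 `stub_landauKernelBounds : LandauVarianceBounded ∧
LandauKernelDecay` of ⟨stmt-QuantumFields-24004⟩/⟨24335⟩, and the U1 package of ⟨24336⟩):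

* `glue_zero_single`, `hodgeQ_entry` — the matrix entry `hodgeQ H e e'`, read off from the row formula `hodgeQ_mulVec_apply` (✓, file
  `…HodgeRows`) at the indicator vector of `e'`;
* `IsRest H x μ` — the REST links `(x, μ)` (at least one endpoint an interior site) in coordinates: transverse coordinates in `[1, 2H−1]`,
  longitudinal coordinate in `[0, 2H−1]`; its complement among the box links is the SKIN (links lying in a face);
* `mem_interiorSites_of_isRest_of_isRest_*` — two PERPENDICULAR rest links sharing a vertex share an INTERIOR vertex (the reason why the
  mixed curl terms cancel against the gauge terms inside the rest block);
* **`hodgeQ_entry_rest_of_ne`**, **`hodgeQ_entry_rest_of_eq`** — §7.2 entrywise: on rest × rest, `hodgeQ` vanishes between links of different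
  directions, and between links of the same direction `μ` it is the scalar box Laplacian with DIRICHLET faces in the directions `ν ≠ μ` and
  NEUMANN faces in the direction `μ` (diagonal `6 + [x_μ+1 < 2H] + [1 ≤ x_μ]`, `−1` per present neighbour `x' = x ± e_ν`).

Everything proved; standard axioms.  HONEST LABEL: bookkeeping toward stub S3b of a critic-stamped line on the R2ξ″ crux; no stub is closed
by name here, no crux, rung or summit is proved; the Yang–Mills mass gap is NOT proved by this file.
-/

set_option autoImplicit false

noncomputable section

namespace Summit.QuantumFields.YangMills.Theorems.AllWindowsColdBoxBoxHighLine

open Finset Matrix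
open Literature.Probability.LatticeModels (Site)
open Literature.MathematicalPhysics.QuantumFieldTheory
open Literature.MathematicalPhysics.QuantumFieldTheory.LatticeMaxwell
open Literature.MathematicalPhysics.QuantumFieldTheory.AxialGauge
open Summit.QuantumFields.YangMills.Theorems.WeakCouplingRates

namespace RestBlock

variable {H : ℕ}

/-! ## The entries of `hodgeQ` -/

/-- The indicator edge function of the free edge `e'` on all edges of `ℤ⁴`. -/
def ind (e' : LandauFree H) (f : Literature.MathematicalPhysics.QuantumLattice.ZdEdge 4) : ℝ := if f = e'.1.1 then 1 else 0

/-- The indicator at an edge `(y, i)`: `1` iff `y` is the base point and `i` the direction of `e'`. -/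
theorem ind_apply (e' : LandauFree H) (y : Site 4) (i : Fin 4) :
    ind e' (y, i) = if e'.1.1.1 = y ∧ e'.1.1.2 = i then 1 else 0 := by
  unfold ind
  congr 1
  rw [Prod.ext_iff]
  simp only [eq_comm]

/-- The zero extension of the indicator vector of a free edge is the indicator edge function. -/
theorem glue_zero_single (e' : LandauFree H) :
    glue (pin := landauPin H) dirCorner (2 * H + 3) 0 (Pi.single e' 1) = ind e' := by
  funext f
  unfold glue ind
  by_cases hf : f ∈ boxEdgesAt dirCorner (2 * H + 3)
  · rw [dif_pos hf]
    by_cases hp : landauPin H f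
    · rw [dif_pos hp]
      have hne : f ≠ e'.1.1 := fun h => e'.2 (h ▸ hp)
      simp [hne]
    · rw [dif_neg hp, Pi.single_apply]
      congr 1
      apply propext
      constructor
      · intro h; rw [← h]
      · intro h; exact Subtype.ext (Subtype.ext h)
  · rw [dif_neg hf]
    have hne : f ≠ e'.1.1 := fun h => hf (h ▸ e'.1.2)
    simp [hne]

/-- **The entry `hodgeQ H e e'`** (`e = (x, μ)`): the row formula `hodgeQ_mulVec_apply` at the indicator vector of `e'`. -/
theorem hodgeQ_entry (e e' : LandauFree H) :
    hodgeQ H e e' =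
      ((∑ ν : Fin 4, if e.1.1.2 < ν then
          (ind e' (e.1.1.1, e.1.1.2) + ind e' (e.1.1.1 + Pi.single e.1.1.2 1, ν) - ind e' (e.1.1.1 + Pi.single ν 1, e.1.1.2) -
              ind e' (e.1.1.1, ν)) -
          (ind e' (e.1.1.1 - Pi.single ν 1, e.1.1.2) + ind e' (e.1.1.1 - Pi.single ν 1 + Pi.single e.1.1.2 1, ν) -
            ind e' (e.1.1.1 - Pi.single ν 1 + Pi.single ν 1, e.1.1.2) - ind e' (e.1.1.1 - Pi.single ν 1, ν)) else 0) +
        ∑ ν : Fin 4, if ν < e.1.1.2 then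
          (ind e' (e.1.1.1 - Pi.single ν 1, ν) + ind e' (e.1.1.1 - Pi.single ν 1 + Pi.single ν 1, e.1.1.2) -
            ind e' (e.1.1.1 - Pi.single ν 1 + Pi.single e.1.1.2 1, ν) - ind e' (e.1.1.1 - Pi.single ν 1, e.1.1.2)) -
          (ind e' (e.1.1.1, ν) + ind e' (e.1.1.1 + Pi.single ν 1, e.1.1.2) - ind e' (e.1.1.1 + Pi.single e.1.1.2 1, ν) -
            ind e' (e.1.1.1, e.1.1.2)) else 0) +
      ((if e.1.1.1 + Pi.single e.1.1.2 1 ∈ interiorSites H then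
          ∑ i : Fin 4, (ind e' (e.1.1.1 + Pi.single e.1.1.2 1 - Pi.single i 1, i) - ind e' (e.1.1.1 + Pi.single e.1.1.2 1, i)) else 0) -
        (if e.1.1.1 ∈ interiorSites H then ∑ i : Fin 4, (ind e' (e.1.1.1 - Pi.single i 1, i) - ind e' (e.1.1.1, i)) else 0)) := by
  have h1 : hodgeQ H e e' = (hodgeQ H *ᵥ Pi.single e' 1) e := by rw [Matrix.mulVec_single_one]; rfl
  rw [h1]
  exact hodgeQ_mulVec_apply (Pi.single e' 1) e (ind e') (glue_zero_single e').symm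

/-! ## Rest links in coordinates -/

/-- Membership in `interiorSites`: all coordinates in `[1, 2H−1]`. -/
theorem mem_interiorSites_iff (x : Site 4) : x ∈ interiorSites H ↔ ∀ k, 1 ≤ x k ∧ x k ≤ 2 * (H : ℤ) - 1 := by
  simp [interiorSites, Fintype.mem_piFinset]

variable (H) in
/-- **Rest links** `(x, μ)` of the cold box (at least one endpoint an interior site), in coordinates: `x_ν ∈ [1, 2H−1]` for `ν ≠ μ` and
`x_μ ∈ [0, 2H−1]`. -/
def IsRest (x : Site 4) (μ : Fin 4) : Prop := (∀ ν, ν ≠ μ → 1 ≤ x ν ∧ x ν ≤ 2 * (H : ℤ) - 1) ∧ 0 ≤ x μ ∧ x μ ≤ 2 * (H : ℤ) - 1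

/-- A link with an interior endpoint is a rest link. -/
theorem isRest_of_mem_or_mem {x : Site 4} {μ : Fin 4} (h : x ∈ interiorSites H ∨ x + Pi.single μ 1 ∈ interiorSites H) :
    IsRest H x μ := by
  rcases h with h | h
  · rw [mem_interiorSites_iff] at h
    exact ⟨fun ν _ => h ν, by have := h μ; omega, (h μ).2⟩
  · rw [mem_interiorSites_iff] at h
    refine ⟨fun ν hν => ?_, ?_, ?_⟩
    · have := h ν; simpa [Pi.add_apply, Pi.single_apply, hν] using this
    · have := h μ; simp [Pi.add_apply] at this; omega
    · have := h μ; simp [Pi.add_apply] at this; omega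

/-- A rest link has an interior endpoint (for `H ≥ 1`). -/
theorem mem_or_mem_of_isRest (hH : 1 ≤ H) {x : Site 4} {μ : Fin 4} (h : IsRest H x μ) :
    x ∈ interiorSites H ∨ x + Pi.single μ 1 ∈ interiorSites H := by
  by_cases hx : 1 ≤ x μ
  · left
    rw [mem_interiorSites_iff]
    intro k
    by_cases hk : k = μ
    · subst hk; exact ⟨hx, h.2.2⟩
    · exact h.1 k hk
  · right
    rw [mem_interiorSites_iff]
    intro k
    by_cases hk : k = μ
    · subst hk; simp [Pi.add_apply]; have := h.2.1; omega
    · have := h.1 k hk; simpa [Pi.add_apply, Pi.single_apply, hk] using this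

/-- The upper endpoint `x + e_μ` of a rest link `(x, μ)` is interior iff `x_μ + 1 < 2H`. -/
theorem add_mem_interiorSites_iff_of_isRest {x : Site 4} {μ : Fin 4} (h : IsRest H x μ) :
    x + Pi.single μ 1 ∈ interiorSites H ↔ x μ + 1 < 2 * (H : ℤ) := by
  rw [mem_interiorSites_iff]
  constructor
  · intro hk; have := hk μ; simp [Pi.add_apply] at this; omega
  · intro hlt k
    by_cases hk : k = μ
    · subst hk; simp [Pi.add_apply]; have := h.2.1; omega
    · have := h.1 k hk; simpa [Pi.add_apply, Pi.single_apply, hk] using this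

/-- The lower endpoint `x` of a rest link `(x, μ)` is interior iff `1 ≤ x_μ`. -/
theorem mem_interiorSites_iff_of_isRest {x : Site 4} {μ : Fin 4} (h : IsRest H x μ) :
    x ∈ interiorSites H ↔ 1 ≤ x μ := by
  rw [mem_interiorSites_iff]
  constructor
  · intro hk; exact (hk μ).1
  · intro hle k
    by_cases hk : k = μ
    · subst hk; exact ⟨hle, h.2.2⟩
    · exact h.1 k hk

/-- **Two perpendicular rest links based at the same point have an interior base point.** -/
theorem mem_interiorSites_of_isRest_of_isRest {x : Site 4} {μ μ' : Fin 4} (hne : μ ≠ μ') (h : IsRest H x μ) (h' : IsRest H x μ') :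
    x ∈ interiorSites H := by
  rw [mem_interiorSites_iff]
  intro k
  by_cases hk : k = μ
  · subst hk; exact h'.1 k hne
  · exact h.1 k hk

/-- Perpendicular rest links `(x, μ)` and `(x + e_μ, μ')`: the shared vertex `x + e_μ` is interior. -/
theorem add_mem_interiorSites_of_isRest_of_isRest {x : Site 4} {μ μ' : Fin 4} (hne : μ ≠ μ') (h : IsRest H x μ)
    (h' : IsRest H (x + Pi.single μ 1) μ') : x + Pi.single μ 1 ∈ interiorSites H := by
  rw [mem_interiorSites_iff]
  intro k
  by_cases hk : k = μ
  · subst hk; exact h'.1 k hne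
  · have := h.1 k hk; simpa [Pi.add_apply, Pi.single_apply, hk] using this

/-- Perpendicular rest links `(x, μ)` and `(x − e_{μ'}, μ')`: the shared vertex `x` is interior. -/
theorem mem_interiorSites_of_isRest_of_isRest_sub {x : Site 4} {μ μ' : Fin 4} (hne : μ ≠ μ') (h : IsRest H x μ)
    (h' : IsRest H (x - Pi.single μ' 1) μ') : x ∈ interiorSites H := by
  rw [mem_interiorSites_iff]
  intro k
  by_cases hk : k = μ
  · subst hk
    have := h'.1 k hne
    simp [Pi.sub_apply, hne] at this
    omega
  · exact h.1 k hk

/-- Perpendicular rest links `(x, μ)` and `(x + e_μ − e_{μ'}, μ')`: the shared vertex `x + e_μ` is interior. -/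
theorem add_mem_interiorSites_of_isRest_of_isRest_sub {x : Site 4} {μ μ' : Fin 4} (hne : μ ≠ μ') (h : IsRest H x μ)
    (h' : IsRest H (x + Pi.single μ 1 - Pi.single μ' 1) μ') : x + Pi.single μ 1 ∈ interiorSites H := by
  rw [mem_interiorSites_iff]
  intro k
  by_cases hk : k = μ
  · subst hk
    have := h'.1 k hne
    simp [Pi.sub_apply, Pi.add_apply, hne] at this
    simp [Pi.add_apply]
    omega
  · have := h.1 k hk; simpa [Pi.add_apply, Pi.single_apply, hk] using this

/-- Collinear rest links `(x, μ)` and `(x + e_μ, μ)`: the shared vertex `x + e_μ` is interior. -/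
theorem add_mem_interiorSites_of_isRest_add {x : Site 4} {μ : Fin 4} (h : IsRest H x μ) (h' : IsRest H (x + Pi.single μ 1) μ) :
    x + Pi.single μ 1 ∈ interiorSites H := by
  rw [add_mem_interiorSites_iff_of_isRest h]
  have := h'.2.2
  simp [Pi.add_apply] at this
  omega

/-- Collinear rest links `(x, μ)` and `(x − e_μ, μ)`: the shared vertex `x` is interior. -/
theorem mem_interiorSites_of_isRest_sub_same {x : Site 4} {μ : Fin 4} (h : IsRest H x μ) (h' : IsRest H (x - Pi.single μ 1) μ) :
    x ∈ interiorSites H := by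
  rw [mem_interiorSites_iff_of_isRest h]
  have := h'.2.1
  simp [Pi.sub_apply] at this
  omega

/-! ## §7.2 entrywise: the rest × rest block of `hodgeQ` -/

/-- In a direction different from that of `e'`, the indicator vanishes. -/
theorem ind_of_ne (e' : LandauFree H) (y : Site 4) {i : Fin 4} (h : e'.1.1.2 ≠ i) : ind e' (y, i) = 0 := by
  rw [ind_apply, if_neg (fun hc => h hc.2)]

/-- In the direction of `e'`, the indicator tests the base point. -/
theorem ind_same (e' : LandauFree H) (y : Site 4) : ind e' (y, e'.1.1.2) = if e'.1.1.1 = y then 1 else 0 := by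
  rw [ind_apply]; simp

/-- **§7.2 (i): rest links of DIFFERENT directions do not interact through `hodgeQ`** — the mixed curl terms of the plaquettes through both
links cancel exactly against the gauge modes of the shared vertex, which is interior. -/
theorem hodgeQ_entry_rest_of_ne (e e' : LandauFree H) (hμ : e.1.1.2 ≠ e'.1.1.2) (he : IsRest H e.1.1.1 e.1.1.2)
    (he' : IsRest H e'.1.1.1 e'.1.1.2) : hodgeQ H e e' = 0 := by
  rw [hodgeQ_entry]
  set x := e.1.1.1 with hx
  set μ := e.1.1.2 with hμdef
  set x' := e'.1.1.1 with hx'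
  set μ' := e'.1.1.2 with hμ'def
  have h0 : ∀ y : Site 4, ind e' (y, μ) = 0 := fun y => ind_of_ne e' y (Ne.symm hμ)
  have h1 : ∀ (y : Site 4) (ν : Fin 4), ν ≠ μ' → ind e' (y, ν) = 0 := fun y ν hν => ind_of_ne e' y (Ne.symm hν)
  have h2 : ∀ y : Site 4, ind e' (y, μ') = if x' = y then 1 else 0 := fun y => ind_same e' y
  rw [Fintype.sum_eq_single μ' (fun ν hν => by simp [h0, h1 _ _ hν]),
    Fintype.sum_eq_single μ' (fun ν hν => by simp [h0, h1 _ _ hν])]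
  have hg1 : (∑ i : Fin 4, (ind e' (x + Pi.single μ 1 - Pi.single i 1, i) - ind e' (x + Pi.single μ 1, i))) =
      ind e' (x + Pi.single μ 1 - Pi.single μ' 1, μ') - ind e' (x + Pi.single μ 1, μ') :=
    Fintype.sum_eq_single μ' (fun ν hν => by simp [h1 _ _ hν])
  have hg2 : (∑ i : Fin 4, (ind e' (x - Pi.single i 1, i) - ind e' (x, i))) = ind e' (x - Pi.single μ' 1, μ') - ind e' (x, μ') :=
    Fintype.sum_eq_single μ' (fun ν hν => by simp [h1 _ _ hν])
  rw [hg1, hg2]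
  simp only [h0, h2, sub_add_eq_add_sub, zero_add, add_zero, sub_zero]
  -- the four vertex facts
  have v1 : x' = x + Pi.single μ 1 → x + Pi.single μ 1 ∈ interiorSites H := fun h =>
    add_mem_interiorSites_of_isRest_of_isRest hμ he (h ▸ he')
  have v2 : x' = x → x ∈ interiorSites H := fun h => mem_interiorSites_of_isRest_of_isRest hμ he (h ▸ he')
  have v3 : x' = x + Pi.single μ 1 - Pi.single μ' 1 → x + Pi.single μ 1 ∈ interiorSites H := fun h =>
    add_mem_interiorSites_of_isRest_of_isRest_sub hμ he (h ▸ he')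
  have v4 : x' = x - Pi.single μ' 1 → x ∈ interiorSites H := fun h => mem_interiorSites_of_isRest_of_isRest_sub hμ he (h ▸ he')
  rcases lt_or_gt_of_ne hμ with hlt | hlt
  · have hnl : ¬ μ' < μ := not_lt_of_gt hlt
    by_cases hi1 : x + Pi.single μ 1 ∈ interiorSites H <;> by_cases hi2 : x ∈ interiorSites H
    · simp [hlt, hnl, hi1, hi2]; ring
    · have n2 : x' ≠ x := fun h => hi2 (v2 h)
      have n4 : x' ≠ x - Pi.single μ' 1 := fun h => hi2 (v4 h)
      simp [hlt, hnl, hi1, hi2, n2, n4]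
    · have n1 : x' ≠ x + Pi.single μ 1 := fun h => hi1 (v1 h)
      have n3 : x' ≠ x + Pi.single μ 1 - Pi.single μ' 1 := fun h => hi1 (v3 h)
      simp [hlt, hnl, hi1, hi2, n1, n3]
    · have n1 : x' ≠ x + Pi.single μ 1 := fun h => hi1 (v1 h)
      have n2 : x' ≠ x := fun h => hi2 (v2 h)
      have n3 : x' ≠ x + Pi.single μ 1 - Pi.single μ' 1 := fun h => hi1 (v3 h)
      have n4 : x' ≠ x - Pi.single μ' 1 := fun h => hi2 (v4 h)
      simp [hlt, hnl, hi1, hi2, n1, n2, n3, n4]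
  · have hnl : ¬ μ < μ' := not_lt_of_gt hlt
    by_cases hi1 : x + Pi.single μ 1 ∈ interiorSites H <;> by_cases hi2 : x ∈ interiorSites H
    · simp [hlt, hnl, hi1, hi2]; ring
    · have n2 : x' ≠ x := fun h => hi2 (v2 h)
      have n4 : x' ≠ x - Pi.single μ' 1 := fun h => hi2 (v4 h)
      simp [hlt, hnl, hi1, hi2, n2, n4]
    · have n1 : x' ≠ x + Pi.single μ 1 := fun h => hi1 (v1 h)
      have n3 : x' ≠ x + Pi.single μ 1 - Pi.single μ' 1 := fun h => hi1 (v3 h)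
      simp [hlt, hnl, hi1, hi2, n1, n3]
    · have n1 : x' ≠ x + Pi.single μ 1 := fun h => hi1 (v1 h)
      have n2 : x' ≠ x := fun h => hi2 (v2 h)
      have n3 : x' ≠ x + Pi.single μ 1 - Pi.single μ' 1 := fun h => hi1 (v3 h)
      have n4 : x' ≠ x - Pi.single μ' 1 := fun h => hi2 (v4 h)
      simp [hlt, hnl, hi1, hi2, n1, n2, n3, n4]

/-- **§7.2 (ii): between rest links of the SAME direction `μ`, `hodgeQ` is the scalar box Laplacian** on the base points, with Dirichlet
faces in the directions `ν ≠ μ` (coefficient `1` kept for the missing neighbour) and Neumann faces in the direction `μ` (diagonal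
coefficients `[x_μ + 1 < 2H]`, `[1 ≤ x_μ]`), and `−1` for each present neighbour `x' = x ± e_ν`. -/
theorem hodgeQ_entry_rest_of_eq (e e' : LandauFree H) (hμ : e.1.1.2 = e'.1.1.2) (he : IsRest H e.1.1.1 e.1.1.2)
    (he' : IsRest H e'.1.1.1 e'.1.1.2) :
    hodgeQ H e e' = ∑ ν : Fin 4,
      ((if e'.1.1.1 = e.1.1.1 then
          ((if ν ≠ e.1.1.2 ∨ e.1.1.1 e.1.1.2 + 1 < 2 * (H : ℤ) then (1 : ℝ) else 0) +
            (if ν ≠ e.1.1.2 ∨ 1 ≤ e.1.1.1 e.1.1.2 then (1 : ℝ) else 0)) else 0) -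
        (if e'.1.1.1 = e.1.1.1 + Pi.single ν 1 then 1 else 0) - (if e'.1.1.1 = e.1.1.1 - Pi.single ν 1 then 1 else 0)) := by
  rw [hodgeQ_entry]
  set x := e.1.1.1 with hx
  set μ := e.1.1.2 with hμdef
  set x' := e'.1.1.1 with hx'
  have he'μ : IsRest H x' μ := by rw [hμ]; exact he'
  have h1 : ∀ (y : Site 4) (ν : Fin 4), ν ≠ μ → ind e' (y, ν) = 0 := fun y ν hν => ind_of_ne e' y (by rw [← hμ]; exact Ne.symm hν)
  have h2 : ∀ y : Site 4, ind e' (y, μ) = if x' = y then 1 else 0 := fun y => by rw [hμ]; exact ind_same e' y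
  have hg1 : (∑ i : Fin 4, (ind e' (x + Pi.single μ 1 - Pi.single i 1, i) - ind e' (x + Pi.single μ 1, i))) =
      ind e' (x + Pi.single μ 1 - Pi.single μ 1, μ) - ind e' (x + Pi.single μ 1, μ) :=
    Fintype.sum_eq_single μ (fun ν hν => by simp [h1 _ _ hν])
  have hg2 : (∑ i : Fin 4, (ind e' (x - Pi.single i 1, i) - ind e' (x, i))) = ind e' (x - Pi.single μ 1, μ) - ind e' (x, μ) :=
    Fintype.sum_eq_single μ (fun ν hν => by simp [h1 _ _ hν])
  rw [hg1, hg2]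
  -- the gauge part is the `ν = μ` term
  have hI1 : (x + Pi.single μ 1 ∈ interiorSites H) ↔ x μ + 1 < 2 * (H : ℤ) := add_mem_interiorSites_iff_of_isRest he
  have hI2 : (x ∈ interiorSites H) ↔ 1 ≤ x μ := mem_interiorSites_iff_of_isRest he
  have v1 : x' = x + Pi.single μ 1 → x μ + 1 < 2 * (H : ℤ) := fun h => by
    have := (add_mem_interiorSites_iff_of_isRest he).1 (add_mem_interiorSites_of_isRest_add he (h ▸ he'μ)); exact this
  have v2 : x' = x - Pi.single μ 1 → 1 ≤ x μ := fun h =>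
    (mem_interiorSites_iff_of_isRest he).1 (mem_interiorSites_of_isRest_sub_same he (h ▸ he'μ))
  have key : ∀ ν : Fin 4,
      ((if μ < ν then
          (ind e' (x, μ) + ind e' (x + Pi.single μ 1, ν) - ind e' (x + Pi.single ν 1, μ) - ind e' (x, ν)) -
          (ind e' (x - Pi.single ν 1, μ) + ind e' (x - Pi.single ν 1 + Pi.single μ 1, ν) -
            ind e' (x - Pi.single ν 1 + Pi.single ν 1, μ) - ind e' (x - Pi.single ν 1, ν)) else 0) +
        (if ν < μ then
          (ind e' (x - Pi.single ν 1, ν) + ind e' (x - Pi.single ν 1 + Pi.single ν 1, μ) -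
            ind e' (x - Pi.single ν 1 + Pi.single μ 1, ν) - ind e' (x - Pi.single ν 1, μ)) -
          (ind e' (x, ν) + ind e' (x + Pi.single ν 1, μ) - ind e' (x + Pi.single μ 1, ν) - ind e' (x, μ)) else 0)) +
      (if ν = μ then
        ((if x + Pi.single μ 1 ∈ interiorSites H then ind e' (x + Pi.single μ 1 - Pi.single μ 1, μ) - ind e' (x + Pi.single μ 1, μ) else 0) -
          (if x ∈ interiorSites H then ind e' (x - Pi.single μ 1, μ) - ind e' (x, μ) else 0)) else 0) =
      (if x' = x then
          ((if ν ≠ μ ∨ x μ + 1 < 2 * (H : ℤ) then (1 : ℝ) else 0) + (if ν ≠ μ ∨ 1 ≤ x μ then (1 : ℝ) else 0)) else 0) -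
        (if x' = x + Pi.single ν 1 then 1 else 0) - (if x' = x - Pi.single ν 1 then 1 else 0) := by
    intro ν
    rcases lt_trichotomy μ ν with hlt | heq | hgt
    · have hnl : ¬ ν < μ := not_lt_of_gt hlt
      have hne : ν ≠ μ := ne_of_gt hlt
      simp [hlt, hnl, hne, h1 _ _ hne, h2, sub_add_cancel]
      split_ifs <;> ring
    · subst heq
      simp only [lt_irrefl, if_false, if_true, zero_add, h2, add_sub_cancel_right, ne_eq, not_true, false_or, hI1, hI2]
      by_cases c1 : x μ + 1 < 2 * (H : ℤ) <;> by_cases c2 : 1 ≤ x μ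
      · simp [c1, c2]
        split_ifs <;> ring
      · have n2 : x' ≠ x - Pi.single μ 1 := fun h => c2 (v2 h)
        simp [c1, c2, n2]
      · have n1 : x' ≠ x + Pi.single μ 1 := fun h => c1 (v1 h)
        simp [c1, c2, n1]
      · have n1 : x' ≠ x + Pi.single μ 1 := fun h => c1 (v1 h)
        have n2 : x' ≠ x - Pi.single μ 1 := fun h => c2 (v2 h)
        simp [c1, c2, n1, n2]
    · have hnl : ¬ μ < ν := not_lt_of_gt hgt
      have hne : ν ≠ μ := ne_of_lt hgt
      simp [hgt, hnl, hne, h1 _ _ hne, h2, sub_add_cancel]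
      split_ifs <;> ring
  rw [← Finset.sum_congr rfl fun ν _ => key ν, Finset.sum_add_distrib, Finset.sum_add_distrib, Finset.sum_ite_eq' Finset.univ μ,
    if_pos (Finset.mem_univ _)]

end RestBlock

end Summit.QuantumFields.YangMills.Theorems.AllWindowsColdBoxBoxHighLine

end
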